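import Literature.Topology.FourManifolds.ThickenSurfaceTwist
import Literature.Topology.FourManifolds.DehnNielsenBaerFlowerTwist
import HarnessLib

/-!
# Dehn–Nielsen–Baer on the flower surface: the Dehn twists about the meridians of `∂V_g`

Topic `Literature/Topology/FourManifolds`; sixth PROOF file of the named fact
`Literature.Topology.FourManifolds.DehnNielsenBaerSurfaceSmooth` (`DehnNielsenBaerSurface.lean`), companion of
`DehnNielsenBaerFlowerTwist.lean` (twists about the hole circles).  Here: **the Dehn twists of the
flower surface `∂V_g = {q_g(x, y) + z² = c_g}` about the meridian
`m₀ = ∂V_g ∩ {y = 0} ∩ {x > 0 beyond the first hole}`** — the boundary of the meridian disc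
`V_g ∩ {y = 0, x near r_b}` of the handlebody over the arc of the `x`-axis crossing the first arm
of the flower domain at the pass `r_b` —, as based diffeomorphisms of `(∂V_g, x₀)` (the meridians of
the other arms are their conjugates by the rotations).  They are the instance `f = y` of
`ThickenSurfaceTwist.exists_thickenSurfaceDehnTwist` (first integrals `H = (y, q_g ∘ π + z²)`):

* `FlowerModel.fderiv_flower_e₁_eq_zero` — `∂q_g/∂y = 0` on the `x`-axis (the flower is symmetric
  in the `x`-axis, `flower_refl`);
* `FlowerModel.exists_delta_fderiv_flower_ax_ne_zero` — **near the `x`-axis and near the level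
  `c_g`, `∂q_g/∂x ≠ 0`** (compactness: at a point of the axis on the level, `∂q_g/∂x = 0` would
  make it critical, but `c_g` is a regular value);
* `FlowerModel.range_fderiv_pairH_y_eq_top` — hence `D(y, q_g ∘ π + z²)` is onto on the preimage
  of a box around `(0, c_g)`;
* `FlowerModel.exists_clampBelow`, `FlowerModel.exists_meridianSection` — a smooth section
  `σ(a, c') = (r_b, a, √(c' - q_g(r_b, a)))` of `H` over a box around `(0, c_g)` (the radicand
  clamped away from `0` off the box), through the point `(r_b, 0, √(c_g - q_g(r_b)))` of `m₀`;
* `FlowerModel.exists_meridianDehnTwist` — **the Dehn twists about `m₀`** as diffeomorphisms of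
  `∂V_g` fixing the base point `x₀ = (0, 0, √c_g)` (which is not on the orbit of `σ(0, c_g)`: along
  that connected orbit `y = 0` and `x` never takes the value `r_a`, where `q_g(r_a, 0) > c_g`, while
  it is `r_b > r_a` at `σ(0, c_g)` and would be `0 < r_a` at `x₀`), with the explicit description of
  `ThickenSurfaceTwist`.

Everything is proved; no new definitions (D-0026).

## References

* B. Farb, D. Margalit, *A primer on mapping class groups*, PMS 49 (2012), §3.1.1, Thm. 4.1 and
  §4.4 (the Lickorish–Humphries twist generators include the meridians), Thm. 8.1.
  [FarbMargalit2012]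
* H. Zieschang, E. Vogt, H.-D. Coldewey, *Surfaces and planar discontinuous groups*, LNM 835 (1980),
  Thm. 5.6.1–5.6.2. [ZieschangVogtColdewey1980]
-/

open scoped Manifold ContDiff Topology Real
open Set Function Filter Metric

noncomputable section

namespace Literature.Topology.FourManifolds

open PlanarThickening Literature.Geometry.Manifold Literature.AlgebraicTopology.FundamentalGroup
  PlanarLevelTwist

/-- Local notation: `𝔼 n` is the model Euclidean space `EuclideanSpace ℝ (Fin n)`. -/
local notation "𝔼 " n:arg => EuclideanSpace ℝ (Fin n)

namespace FlowerModel

variable {g : ℕ}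

/-! ### §1 Coordinates of the frame vectors -/

/-- `e₁ = (0, 1)`: first coordinate. [folklore] -/
@[simp] theorem e₁_apply_zero : e₁ 0 = 0 := by simp [e₁]

/-- `e₁ = (0, 1)`: second coordinate. [folklore] -/
@[simp] theorem e₁_apply_one : e₁ 1 = 1 := by simp [e₁]

/-- The reflection in the `x`-axis reverses `e₁`. [folklore] -/
theorem refl_e₁ : refl e₁ = -e₁ := by
  apply toC.injective
  rw [toC_refl, toC_e₁, map_neg, toC_e₁, Complex.conj_I]

/-- A point of the plane with vanishing second coordinate is an axis point. [folklore] -/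
theorem eq_ax_of_apply_one_eq_zero {p : 𝔼 2} (hp : p 1 = 0) : p = ax (p 0) := by
  ext i
  fin_cases i
  · simp
  · simp [hp]

/-! ### §2 `∂q_g/∂y = 0` on the axis; `∂q_g/∂x ≠ 0` near the axis and the level -/

/-- **The flower has no `y`-derivative on the `x`-axis** (symmetry `q_g(x, -y) = q_g(x, y)`).
[folklore] -/
theorem fderiv_flower_e₁_eq_zero {p : 𝔼 2} (hp : p 1 = 0) : fderiv ℝ (flower g) p e₁ = 0 := by
  have hfix : refl p = p := by rw [eq_ax_of_apply_one_eq_zero hp, refl_ax]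
  have h := fderiv_eq_comp_of_invariant (F := flower g) refl.toContinuousLinearEquiv
    differentiable_flower (fun p => flower_refl p) p
  have h1 : fderiv ℝ (flower g) p e₁ = fderiv ℝ (flower g) p (refl e₁) := by
    conv_lhs => rw [h]
    simp [hfix]
  rw [refl_e₁, map_neg] at h1
  linarith

/-- **Near the `x`-axis and near the level `c_g` the `x`-derivative of the flower does not
vanish**: there is `δ > 0` such that `∂q_g/∂x (p) ≠ 0` whenever `|p_y| < δ` and
`|q_g(p) - c_g| < δ`. [folklore] -/
theorem exists_delta_fderiv_flower_ax_ne_zero (hg : 2 ≤ g) :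
    ∃ δ : ℝ, 0 < δ ∧ ∀ p : 𝔼 2, |p 1| < δ → |flower g p - level g| < δ →
      fderiv ℝ (flower g) p (ax 1) ≠ 0 := by
  have hg1 : 1 ≤ g := by omega
  -- the compact set of bad points with `|y| ≤ 1`, `|q - c| ≤ 1`
  set C : Set (𝔼 2) := {p | |p 1| ≤ 1} ∩ (flower g ⁻¹' Icc (level g - 1) (level g + 1)) ∩
    {p | fderiv ℝ (flower g) p (ax 1) = 0} with hCdef
  have hdc : Continuous fun p : 𝔼 2 => fderiv ℝ (flower g) p (ax 1) :=
    (contDiff_flower.continuous_fderiv (by simp)).clm_apply continuous_const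
  have hCc : IsCompact C := by
    refine (isCompact_flower_preimage_Iic hg1 (level g + 1)).of_isClosed_subset ?_ ?_
    · refine (IsClosed.inter ?_ ?_).inter (isClosed_eq hdc continuous_const)
      · exact isClosed_le (continuous_abs.comp (EuclideanSpace.proj (1 : Fin 2)).continuous)
          continuous_const
      · exact isClosed_Icc.preimage contDiff_flower.continuous
    · rintro p ⟨⟨-, hp⟩, -⟩; exact hp.2
  -- the separating function
  set φ : 𝔼 2 → ℝ := fun p => max |p 1| |flower g p - level g| with hφdef
  have hφc : Continuous φ :=
    (continuous_abs.comp (EuclideanSpace.proj (1 : Fin 2)).continuous).max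
      (continuous_abs.comp (contDiff_flower.continuous.sub continuous_const))
  have hφpos : ∀ p ∈ C, 0 < φ p := by
    rintro p ⟨⟨-, -⟩, hp⟩
    by_contra hle
    have h0 : φ p = 0 := le_antisymm (not_lt.1 hle) (le_max_of_le_left (abs_nonneg _))
    have hy : p 1 = 0 := by
      have : |p 1| ≤ 0 := by rw [← h0]; exact le_max_left _ _
      exact abs_nonpos_iff.1 this
    have hq : flower g p = level g := by
      have : |flower g p - level g| ≤ 0 := by rw [← h0]; exact le_max_right _ _
      linarith [abs_nonpos_iff.1 this]
    -- on the axis `∇q = (∂q/∂x, 0)`, so `p` would be critical on the regular level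
    have hd : fderiv ℝ (flower g) p (ax 1) = 0 := hp
    have hcrit : IsMCriticalPt (𝓡 2) (flower g) p := by
      rw [isMCriticalPt_iff, ← fderiv_flower]
      have hdec : ∀ v : 𝔼 2, v = v 0 • ax 1 + v 1 • e₁ := fun v => by
        ext i; fin_cases i <;> simp
      ext v
      rw [_root_.zero_apply, hdec v, map_add, map_smul, map_smul, hd,
        fderiv_flower_e₁_eq_zero hy, smul_zero, smul_zero, add_zero]
    exact (isHoledDiscMorseFunction_flower hg).apply_ne_of_isMCriticalPt hcrit hq
  by_cases hCne : C.Nonempty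
  · obtain ⟨p₀, hp₀, hmin⟩ := hCc.exists_isMinOn hCne hφc.continuousOn
    refine ⟨min (φ p₀) 1 / 2, div_pos (lt_min (hφpos p₀ hp₀) one_pos) two_pos,
      fun p hy hq hd => ?_⟩
    have hφp : φ p < min (φ p₀) 1 / 2 := max_lt hy hq
    have h1 := min_le_right (φ p₀) 1
    have hpC : p ∈ C := by
      refine ⟨⟨?_, ⟨?_, ?_⟩⟩, hd⟩
      · show |p 1| ≤ 1
        linarith
      · show level g - 1 ≤ flower g p
        have h2 : |flower g p - level g| < 1 := by linarith
        linarith [(abs_lt.1 h2).1]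
      · show flower g p ≤ level g + 1
        have h2 : |flower g p - level g| < 1 := by linarith
        linarith [(abs_lt.1 h2).2]
    have h5 : φ p₀ ≤ φ p := hmin hpC
    have h3 := min_le_left (φ p₀) 1
    have h4 := hφpos p₀ hp₀
    linarith
  · refine ⟨1 / 2, by norm_num, fun p hy hq hd => hCne ⟨p, ⟨⟨?_, ⟨?_, ?_⟩⟩, hd⟩⟩⟩
    · show |p 1| ≤ 1
      linarith
    · show level g - 1 ≤ flower g p
      linarith [(abs_lt.1 hq).1]
    · show flower g p ≤ level g + 1
      linarith [(abs_lt.1 hq).2]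

/-! ### §3 Regularity of `H = (y, q_g ∘ π + z²)` near the meridian level -/

/-- The `y`-coordinate of `ℝ³`. [folklore] -/
theorem contDiff_apply_one : ContDiff ℝ ∞ fun x : 𝔼 3 => x 1 :=
  (EuclideanSpace.proj (1 : Fin 3) : 𝔼 3 →L[ℝ] ℝ).contDiff

/-- The derivative of the `y`-coordinate. [folklore] -/
theorem fderiv_apply_one (x v : 𝔼 3) : fderiv ℝ (fun x : 𝔼 3 => x 1) x v = v 1 := by
  have : (fun x : 𝔼 3 => x 1) = (EuclideanSpace.proj (1 : Fin 3) : 𝔼 3 →L[ℝ] ℝ) := rfl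
  rw [this, ContinuousLinearMap.fderiv]
  rfl

/-- **`D(y, q_g ∘ π + z²)` is onto** at every point with `|y| < δ` and `|q_g ∘ π + z² - c_g| < δ`
for the `δ` of `exists_delta_fderiv_flower_ax_ne_zero` (test vectors `(0, 1, 0)` and `(0, 0, 1)` off
the plane `z = 0`, `(0, 1, 0)` and `(1, 0, 0)` on it). [folklore] -/
theorem range_fderiv_pairH_y_eq_top {δ : ℝ}
    (hδ : ∀ p : 𝔼 2, |p 1| < δ → |flower g p - level g| < δ → fderiv ℝ (flower g) p (ax 1) ≠ 0)
    {x : 𝔼 3} (hy : |x 1| < δ) (ht : |thicken (flower g) x - level g| < δ) :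
    LinearMap.range (fderiv ℝ (pairH (fun x : 𝔼 3 => x 1) (flower g)) x :
      𝔼 3 →ₗ[ℝ] ℝ × ℝ) = ⊤ := by
  have hdiff : Differentiable ℝ fun x : 𝔼 3 => x 1 := contDiff_apply_one.differentiable (by simp)
  by_cases hz : x 2 = 0
  · refine range_fderiv_pairH_eq_top hdiff differentiable_flower (v := lift e₁) (w := lift (ax 1))
      ?_ ?_ ?_
    · rw [fderiv_apply_one]; simp
    · rw [fderiv_apply_one]; simp
    · rw [fderiv_thicken differentiable_flower]
      simp only [_root_.add_apply, ContinuousLinearMap.comp_apply, proj_lift,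
        _root_.smul_apply, zc_apply, lift_apply_two, smul_eq_mul, mul_zero, add_zero]
      refine hδ (proj x) (by simpa using hy) ?_
      have : thicken (flower g) x = flower g (proj x) := by rw [thicken_apply, hz]; ring
      rwa [this] at ht
  · refine range_fderiv_pairH_eq_top hdiff differentiable_flower (v := lift e₁) (w := ez) ?_ ?_ ?_
    · rw [fderiv_apply_one]; simp
    · rw [fderiv_apply_one]; simp
    · rw [fderiv_thicken differentiable_flower]
      simp only [_root_.add_apply, ContinuousLinearMap.comp_apply, proj_ez,
        map_zero, _root_.smul_apply, zc_apply, ez_apply_two, smul_eq_mul, mul_one,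
        zero_add]
      exact mul_ne_zero two_ne_zero hz

/-! ### §4 The section through the meridian -/

/-- **A smooth clamp from below**: `κ(u) = u` for `u ≥ m/2`, `κ ≥ m/4` everywhere (`m > 0`).
[folklore] -/
theorem exists_clampBelow {m : ℝ} (hm : 0 < m) :
    ∃ κ : ℝ → ℝ, ContDiff ℝ ∞ κ ∧ (∀ u, m / 2 ≤ u → κ u = u) ∧ ∀ u, m / 4 ≤ κ u := by
  refine ⟨fun u => m / 4 + (u - m / 4) * Real.smoothTransition ((u - m / 4) / (m / 4)), ?_,
    fun u hu => ?_, fun u => ?_⟩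
  · exact contDiff_const.add ((contDiff_id.sub contDiff_const).mul
      (Real.smoothTransition.contDiff.comp ((contDiff_id.sub contDiff_const).div_const _)))
  · show m / 4 + (u - m / 4) * Real.smoothTransition ((u - m / 4) / (m / 4)) = u
    rw [Real.smoothTransition.one_of_one_le, mul_one]
    · ring
    · rw [le_div_iff₀ (by positivity)]; linarith
  · show m / 4 ≤ m / 4 + (u - m / 4) * Real.smoothTransition ((u - m / 4) / (m / 4))
    rcases le_or_gt (u - m / 4) 0 with h | h
    · rw [Real.smoothTransition.zero_of_nonpos (div_nonpos_of_nonpos_of_nonneg h (by positivity)),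
        mul_zero, add_zero]
    · have := Real.smoothTransition.nonneg ((u - m / 4) / (m / 4))
      nlinarith

/-- **The section through the meridian**: a smooth `σ : ℝ² → ℝ³` with
`σ(a, c') = (r_b, a, √(c' - q_g(r_b, a)))` and `(y, q_g ∘ π + z²)(σ(a, c')) = (a, c')` on a box
around `(0, c_g)`, and `σ(0, c_g) = (r_b, 0, √(c_g - q_g(r_b)))`. [folklore] -/
theorem exists_meridianSection (hg : 2 ≤ g) :
    ∃ (σ : ℝ × ℝ → 𝔼 3) (δ : ℝ), ContDiff ℝ ∞ σ ∧ 0 < δ ∧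
      (∀ s ∈ Ioo (-δ) δ ×ˢ Ioo (level g - δ) (level g + δ),
        pairH (fun x : 𝔼 3 => x 1) (flower g) (σ s) = s) ∧
      (∀ s : ℝ × ℝ, proj (σ s) = ax (rb hg) + s.1 • e₁) ∧
      σ (0, level g) = lift (ax (rb hg)) + Real.sqrt (level g - prof g (rb hg)) • ez := by
  set m : ℝ := level g - prof g (rb hg) with hmdef
  have hm : 0 < m := by have := prof_rb_lt_level hg; linarith
  obtain ⟨κ, hκs, hκid, hκlow⟩ := exists_clampBelow hm
  -- continuity of `a ↦ q(r_b, a)` at `0`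
  have hqc : Continuous fun a : ℝ => flower g (ax (rb hg) + a • e₁) :=
    contDiff_flower.continuous.comp (continuous_const.add (continuous_id.smul continuous_const))
  obtain ⟨δ₁, hδ₁, hδ₁q⟩ := Metric.continuous_iff.1 hqc 0 (m / 4) (by positivity)
  set δ : ℝ := min δ₁ (m / 4) with hδdef
  have hδ : 0 < δ := lt_min hδ₁ (by positivity)
  set σ : ℝ × ℝ → 𝔼 3 := fun s =>
    lift (ax (rb hg) + s.1 • e₁) + Real.sqrt (κ (s.2 - flower g (ax (rb hg) + s.1 • e₁))) • ez
    with hσdef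
  have hplanar : ContDiff ℝ ∞ fun s : ℝ × ℝ => ax (rb hg) + s.1 • e₁ :=
    contDiff_const.add (contDiff_fst.smul contDiff_const)
  have hrad : ContDiff ℝ ∞ fun s : ℝ × ℝ => κ (s.2 - flower g (ax (rb hg) + s.1 • e₁)) :=
    hκs.comp (contDiff_snd.sub (contDiff_flower.comp hplanar))
  have hsq : ContDiff ℝ ∞ fun s : ℝ × ℝ =>
      Real.sqrt (κ (s.2 - flower g (ax (rb hg) + s.1 • e₁))) :=
    contDiff_iff_contDiffAt.2 fun s => (hrad.contDiffAt).sqrt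
      (by have := hκlow (s.2 - flower g (ax (rb hg) + s.1 • e₁))
          exact (lt_of_lt_of_le (by positivity) this).ne')
  have hσs : ContDiff ℝ ∞ σ :=
    (lift.contDiff.comp hplanar).add (hsq.smul (contDiff_const (c := ez)))
  refine ⟨σ, δ, hσs, hδ, fun s hs => ?_, fun s => ?_, ?_⟩
  · obtain ⟨⟨ha1, ha2⟩, ⟨hc1, hc2⟩⟩ := hs
    have haδ₁ : dist s.1 0 < δ₁ := by
      rw [Real.dist_eq, sub_zero, abs_lt]
      exact ⟨by linarith [min_le_left δ₁ (m / 4)], by linarith [min_le_left δ₁ (m / 4)]⟩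
    have hq := hδ₁q s.1 haδ₁
    rw [Real.dist_eq, zero_smul, add_zero, flower_ax'] at hq
    have hrad' : m / 2 ≤ s.2 - flower g (ax (rb hg) + s.1 • e₁) := by
      have h1 := (abs_lt.1 hq).2
      have h2 := min_le_right δ₁ (m / 4)
      rw [hmdef] at h1 ⊢
      linarith
    have hκ := hκid _ hrad'
    have hnn : 0 ≤ s.2 - flower g (ax (rb hg) + s.1 • e₁) := by linarith
    have hp : proj (σ s) = ax (rb hg) + s.1 • e₁ := by simp [hσdef]
    have h2 : σ s 2 = Real.sqrt (κ (s.2 - flower g (ax (rb hg) + s.1 • e₁))) := by simp [hσdef]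
    refine Prod.ext ?_ ?_
    · simp [hσdef, pairH_apply]
    · show thicken (flower g) (σ s) = s.2
      rw [thicken_apply, hp, h2, hκ, Real.sq_sqrt hnn]
      ring
  · simp [hσdef]
  · show lift (ax (rb hg) + (0 : ℝ) • e₁) +
        Real.sqrt (κ (level g - flower g (ax (rb hg) + (0 : ℝ) • e₁))) • ez = _
    rw [zero_smul, add_zero, flower_ax', hκid _ (by rw [hmdef]; linarith)]

/-! ### §5 The Dehn twists about the meridian `m₀` -/

/-- **The Dehn twists of `∂V_g` about the meridian `m₀`** (the curve `{y = 0} ∩ ∂V_g` through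
`(r_b, 0, √(c_g - q_g(r_b)))`), as diffeomorphisms of `∂V_g` fixing the base point `x₀`: a box
half-width `δ > 0`, the section `σ` (`(y, q_g ∘ π + z²) ∘ σ = id` on the box, `π(σ(a, c')) =
(r_b, a)`), the cut-off `ψ` and the flow `θ` of `BoxLevelPackage.exists_boxLevelPackage` for
`H = (y, q_g ∘ π + z²)`, one positive period of the meridian, and for every positive period `T₀`
and every `ε₀ > 0` the period function `P` on `S`, a width `0 < ε ≤ ε₀`, the twist profile `λ`
and a diffeomorphism `T` of `∂V_g` with `T x₀ = x₀`, equal to `x ↦ θ(λ(y), x)` at the boundary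
points of the family with `y < 2ε` and to the identity at those off the family or with
`y ∉ [-ε, 0]`. [cite: FarbMargalit2012, §3.1.1 and Thm. 4.1] -/
theorem exists_meridianDehnTwist (hg : 2 ≤ g) :
    ∃ (δ : ℝ) (σ : ℝ × ℝ → 𝔼 3) (ψ : 𝔼 3 → ℝ) (θ : ℝ × 𝔼 3 → 𝔼 3), 0 < δ ∧ ContDiff ℝ ∞ σ ∧
      (∀ s ∈ Ioo (-δ) δ ×ˢ Ioo (level g - δ) (level g + δ),
        pairH (fun x : 𝔼 3 => x 1) (flower g) (σ s) = s) ∧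
      (∀ s : ℝ × ℝ, proj (σ s) = ax (rb hg) + s.1 • e₁) ∧
      σ (0, level g) = lift (ax (rb hg)) + Real.sqrt (level g - prof g (rb hg)) • ez ∧
      ContDiff ℝ ∞ ψ ∧
      (∀ x, pairH (fun x : 𝔼 3 => x 1) (flower g) x ∈
          Ioo (-δ) δ ×ˢ Ioo (level g - δ) (level g + δ) → ψ x = 1) ∧
      (∀ x, pairH (fun x : 𝔼 3 => x 1) (flower g) x ∉
          Ioo (-(2 * δ)) (2 * δ) ×ˢ Ioo (level g - 2 * δ) (level g + 2 * δ) → ψ x = 0) ∧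
      ContDiff ℝ ∞ θ ∧ (∀ x, θ (0, x) = x) ∧ (∀ t s x, θ (t, θ (s, x)) = θ (t + s, x)) ∧
      (∀ x t, HasDerivAt (fun t => θ (t, x))
        (twistField bE3 bF2 (pairH (fun x : 𝔼 3 => x 1) (flower g)) ψ (θ (t, x))) t) ∧
      (∀ t x, pairH (fun x : 𝔼 3 => x 1) (flower g) (θ (t, x)) =
        pairH (fun x : 𝔼 3 => x 1) (flower g) x) ∧
      (∀ x, ψ x = 0 → ∀ t, θ (t, x) = x) ∧
      (∃ T₀ : ℝ, 0 < T₀ ∧ θ (T₀, σ (0, level g)) = σ (0, level g)) ∧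
      ∀ T₀ : ℝ, 0 < T₀ → θ (T₀, σ (0, level g)) = σ (0, level g) → ∀ ε₀ : ℝ, 0 < ε₀ →
        ∃ (P : ℝ × ℝ → ℝ) (S : Set (ℝ × ℝ)) (ε : ℝ) (lam : ℝ → ℝ)
          (T : (𝓡∂ 3).boundary (FlowerHandlebody hg) ≃ₘ⟮𝓡 2, 𝓡 2⟯
            (𝓡∂ 3).boundary (FlowerHandlebody hg)),
          IsOpen S ∧ (0, level g) ∈ S ∧ S ⊆ Ioo (-δ) δ ×ˢ Ioo (level g - δ) (level g + δ) ∧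
          ContDiffOn ℝ ∞ P S ∧ P (0, level g) = T₀ ∧ (∀ s ∈ S, 0 < P s) ∧
          (∀ s ∈ S, θ (P s, σ s) = σ s) ∧ IsOpen (flowSaturation θ σ S) ∧
          0 < ε ∧ ε ≤ ε₀ ∧ (∀ a ∈ Icc (0 - 3 * ε) (0 + 3 * ε), (a, level g) ∈ S) ∧
          ContDiff ℝ ∞ lam ∧ (∀ a, a ≤ 0 - ε → lam a = 0) ∧
          (∀ a ∈ Icc 0 (0 + 2 * ε), lam a = P (a, level g)) ∧
          T (northPole hg) = northPole hg ∧
          (∀ z, boundaryIncl hg z ∈ flowSaturation θ σ S → boundaryIncl hg z 1 < 0 + 2 * ε →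
            boundaryIncl hg (T z) = θ (lam (boundaryIncl hg z 1), boundaryIncl hg z)) ∧
          ∀ z, (boundaryIncl hg z ∉ flowSaturation θ σ S ∨ boundaryIncl hg z 1 ∉ Icc (0 - ε) 0) →
            T z = z := by
  have hg1 : 1 ≤ g := by omega
  obtain ⟨δr, hδr, hreg0⟩ := exists_delta_fderiv_flower_ax_ne_zero hg
  obtain ⟨σ, δs, hσs, hδs, hHσ0, hσproj, hσ0⟩ := exists_meridianSection hg
  set δ : ℝ := min δr δs with hδdef
  have hδ : 0 < δ := lt_min hδr hδs
  have hreg : ∀ x, pairH (fun x : 𝔼 3 => x 1) (flower g) x ∈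
      Ioo (0 - δ) (0 + δ) ×ˢ Ioo (level g - δ) (level g + δ) →
      LinearMap.range (fderiv ℝ (pairH (fun x : 𝔼 3 => x 1) (flower g)) x :
        𝔼 3 →ₗ[ℝ] ℝ × ℝ) = ⊤ := by
    rintro x ⟨⟨h1, h2⟩, ⟨h3, h4⟩⟩
    simp only [pairH_apply] at h1 h2 h3 h4
    have hr := min_le_left δr δs
    refine range_fderiv_pairH_y_eq_top hreg0 (abs_lt.2 ⟨by linarith, by linarith⟩)
      (abs_lt.2 ⟨by linarith, by linarith⟩)
  have hHσ : ∀ s ∈ Ioo (0 - δ) (0 + δ) ×ˢ Ioo (level g - δ) (level g + δ),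
      pairH (fun x : 𝔼 3 => x 1) (flower g) (σ s) = s := by
    rintro s ⟨⟨h1, h2⟩, ⟨h3, h4⟩⟩
    have hs' := min_le_right δr δs
    exact hHσ0 s ⟨⟨by linarith, by linarith⟩, ⟨by linarith, by linarith⟩⟩
  obtain ⟨ψ, θ, hψs, hψ1, hψzero, hθ, h0, hadd, hint, hHinv, hψfix, hper, htwist⟩ :=
    exists_thickenSurfaceDehnTwist contDiff_flower
      (isCompact_flower_preimage_Iic hg1)
      contDiff_apply_one (isHoledDiscMorseFunction_flower hg).isRegularLevel hδ hreg hσs hHσ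
      (a₀ := 0) (a₁ := 0) (a₂ := 0) ⟨le_rfl, le_rfl⟩
  have hI : Ioo (0 - δ) (0 + δ) = Ioo (-δ) δ := by rw [zero_sub, zero_add]
  have hI2 : Ioo (0 - 2 * δ) (0 + 2 * δ) = Ioo (-(2 * δ)) (2 * δ) := by rw [zero_sub, zero_add]
  rw [hI] at hψ1 hHσ
  rw [hI2] at hψzero
  refine ⟨δ, σ, ψ, θ, hδ, hσs, hHσ, hσproj, hσ0, hψs, hψ1, hψzero, hθ, h0, hadd, hint, hHinv, hψfix,
    hper, fun T₀ hT₀ hT ε₀ hε₀ => ?_⟩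
  obtain ⟨P, S, ε, lam, T, hSo, hs₀S, hSJ, hPs, hP0, hPpos, hPS, hopen, hε, hεε₀, hparS, hlams,
    hlam0, hlam1, hTon, hToff⟩ := htwist T₀ hT₀ hT ε₀ hε₀
  rw [hI] at hSJ
  refine ⟨P, S, ε, lam, T, hSo, hs₀S, hSJ, hPs, hP0, hPpos, hPS, hopen, hε, hεε₀, hparS, hlams,
    hlam0, hlam1, ?_, hTon, hToff⟩
  -- the base point is not on the family: along the orbit of `σ(0, c)` the `x`-coordinate misses `rₐ`
  refine hToff _ (Or.inl fun hmem => ?_)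
  change boundaryIncl hg (northPole hg) ∈ flowSaturation θ σ S at hmem
  rw [boundaryIncl_northPole] at hmem
  obtain ⟨u, s, hs, hus⟩ := mem_flowSaturation_iff.1 hmem
  -- the parameter is `(0, c)`
  have hHtop : pairH (fun x : 𝔼 3 => x 1) (flower g) (top g) = (0, level g) := by
    refine Prod.ext ?_ (thicken_top hg1)
    simp [top]
  have hs0 : s = (0, level g) := by
    rw [← hHσ s (hSJ hs), ← hHinv u (σ s), hus, hHtop]
  subst hs0
  -- the `x`-coordinate along the orbit of `σ(0, c)` takes the values `r_b` and `0`, hence `rₐ`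
  set X : ℝ → ℝ := fun t => θ (t, σ (0, level g)) 0 with hXdef
  have hXc : Continuous X :=
    (EuclideanSpace.proj (0 : Fin 3)).continuous.comp
      (hθ.continuous.comp (continuous_id.prodMk continuous_const))
  have hX0 : X 0 = rb hg := by
    simp only [hXdef, h0, hσ0]
    simp
  have hXu : X u = 0 := by
    simp only [hXdef, hus, top]
    simp
  obtain ⟨t, ht⟩ : ra hg ∈ range X := by
    refine intermediate_value_univ u 0 hXc ⟨?_, ?_⟩
    · rw [hXu]; exact (ra_pos hg).le
    · rw [hX0]; exact (ra_lt_rb hg).le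
  -- at that time the orbit point lies over the peak `(rₐ, 0)`, above the level: not on the surface
  set x := θ (t, σ (0, level g)) with hxdef
  have hHx : pairH (fun x : 𝔼 3 => x 1) (flower g) x = (0, level g) := by
    rw [hxdef, hHinv, hHσ _ ⟨⟨by linarith, by linarith⟩, ⟨by linarith, by linarith⟩⟩]
  simp only [pairH_apply, Prod.mk.injEq] at hHx
  have hproj : proj x = ax (ra hg) := by
    have h1 : proj x 1 = 0 := by rw [proj_apply_one]; exact hHx.1
    rw [eq_ax_of_apply_one_eq_zero h1, proj_apply_zero]
    exact congrArg ax ht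
  have hth : thicken (flower g) x = prof g (ra hg) + x 2 ^ 2 := by
    rw [thicken_apply, hproj, flower_ax']
  have := level_lt_prof_ra hg
  nlinarith [hHx.2, hth, sq_nonneg (x 2)]

end FlowerModel

end Literature.Topology.FourManifolds

end
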